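import Summits.KontsevichZagierPeriods.KontsevichZagierPeriods.Theses.EulerFormChain
import Summits.KontsevichZagierPeriods.KontsevichZagierPeriods.Theorems.FurushoPentagonSectorToKernelOfLeaves
import Summits.KontsevichZagierPeriods.KontsevichZagierPeriods.Theorems.HurwitzMicroSectorsNormalFormPrincipleSplitGlue

/-!
# Split of the deciding crux `PiPowerStratum` (stmt-KontsevichZagierPeriods-11792, route EulerFormChain)

Crux-strategist re-audit (RESTATED bin), 2026-08-17.  `PiPowerStratum` is Conjecture 1 in Tate normal
form (summit-equivalent, `closes`).  BC2 REDIRECT: the three-piece cut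

  `CubeResolution ∧ AyoubCubeLocalKernel ∧ AyoubPiCancellation → PiPowerStratum`

along (geometry inside the rules) / (Kontsevich–Ayoub transcendence core, localised at `[π]`, read on
Ayoub's cube presentation) / (`[π]` is a non-zero-divisor of `FormalRep ⧸ relations`).  It is the common
refinement of the hub's two standing cuts of the summit kernel form: the cube cut
`CubeResolution ∧ AyoubEffectiveCubeKernel` (stmt-17978 ∧ stmt-18116; HermiteRigidity / SphericalSchlafli)
and the π-localisation cut `AyoubPiLocalKernel ∧ AyoubPiCancellation` (stmt-0541 ∧ stmt-0540;
AyoubSpecialisation): the middle piece is implied by stmt-0541 (restriction to one cube class) and by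
stmt-18116 (landed real-Stokes transfer, `N = 0`), and implies neither.
-/

noncomputable section

-- `Summit.KontsevichZagierPeriods.KontsevichZagierPeriods.…` is the tree's mandated layout (single-conjunct summit).
set_option linter.dupNamespace false

namespace Summit.KontsevichZagierPeriods.KontsevichZagierPeriods.Cruxes.PiPowerStratum.Split

open Literature.NumberTheory.Transcendental
open Literature.NumberTheory.Transcendental.KZ hiding cubicalSpan
open Summit.KontsevichZagierPeriods.FurushoPentagon.ReducedPeriodRing (unitCube cubicalGens cubicalSpan
  stub_cubeMerge)
open Summit.KontsevichZagierPeriods.FurushoPentagon.SectorToKernel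
open Summit.KontsevichZagierPeriods.KontsevichZagierPeriods.Theses.EulerFormChain (PiPowerStratum)

/-- X₁ — CUBE RESOLUTION (geometry inside the rules); verbatim the signature of item
stmt-KontsevichZagierPeriods-17978 (`HermiteRigidity.CubeResolution` = `SphericalSchlafli.CubeResolution`). -/
def CubeResolution : Prop :=
  ∀ (N : ℕ) (u : Literature.NumberTheory.Transcendental.KZ.IntegralRep N), ∃ c ∈ AddSubgroup.closure {d : Literature.NumberTheory.Transcendental.KZ.FormalRep | ∃ (n : ℕ) (r : Literature.NumberTheory.Transcendental.KZ.IntegralRep n), r.domain = {x : Fin n → ℝ | ∀ i, 0 ≤ x i ∧ x i ≤ 1} ∧ AnalyticOnNhd ℝ r.integrand {x : Fin n → ℝ | ∀ i, 0 ≤ x i ∧ x i ≤ 1} ∧ d = Literature.NumberTheory.Transcendental.KZ.of r}, Literature.NumberTheory.Transcendental.KZ.of u - c ∈ Literature.NumberTheory.Transcendental.KZ.relations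

/-- X₂ — AYOUB CUBE CLASSES: THE KERNEL AFTER INVERTING `[π]` (NEW piece).  For every pinned disc
product `P n r = [π] ⋆ r` and every integral representation `s` on the closed unit cube `[0,1]ᵐ` whose
integrand is, on the cube, the sum of a real power series of polyradius `> 1` that is algebraic over
`ℚ(x₁,…,xₘ)` (Ayoub's `𝒪_{ℚ-alg}(𝔻̄ᵐ)`, real points), `∫ s = 0` implies that some disc-power multiple
`[π]^{⋆N} ⋆ [s]` lies in `KZ.relations`. -/
def AyoubCubeLocalKernel : Prop :=
  ∀ (P : ∀ n : ℕ, Literature.NumberTheory.Transcendental.KZ.IntegralRep n → Literature.NumberTheory.Transcendental.KZ.IntegralRep (n + 2)), (∀ (n : ℕ) (r : Literature.NumberTheory.Transcendental.KZ.IntegralRep n), (P n r).domain = {z : Fin (n + 2) → ℝ | z 0 ^ 2 + z 1 ^ 2 ≤ 1 ∧ (fun i : Fin n => z i.succ.succ) ∈ r.domain} ∧ (P n r).integrand = fun z => r.integrand (fun i : Fin n => z i.succ.succ)) → ∀ (m : ℕ) (s : Literature.NumberTheory.Transcendental.KZ.IntegralRep m), s.domain = {x : Fin m → ℝ | ∀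 i, 0 ≤ x i ∧ x i ≤ 1} → (∃ (F : MvPowerSeries (Fin m) ℝ) (ρ : ℝ), 1 < ρ ∧ Summable (fun a : Fin m →₀ ℕ => |MvPowerSeries.coeff a F| * ρ ^ (a.sum fun _ e => e)) ∧ (∀ x ∈ {x : Fin m → ℝ | ∀ i, 0 ≤ x i ∧ x i ≤ 1}, HasSum (fun a : Fin m →₀ ℕ => MvPowerSeries.coeff a F * a.prod (fun j e => x j ^ e)) (s.integrand x)) ∧ ∃ Q : Polynomial (MvPolynomial (Fin m) ℚ), Q ≠ 0 ∧ ∀ x ∈ {x : Fin m → ℝ | ∀ i, 0 ≤ x i ∧ x i ≤ 1}, Polynomial.eval₂ (MvPolynomial.aeval x : MvPolynomial (Fin m) ℚ →ₐ[ℚ] ℝ).toRingHom (s.integrand x) Q = 0) → s.value = 0 → ∃ N : ℕ, (⇑(FreeAbelianGroup.lift (fun t : (Σ n, Literature.NumberTheory.Transcendental.KZ.IntegralRep n) => Literature.NumberTheory.Transcendental.KZ.of (P t.1 t.2))))^[N] (Literature.NumberTheory.Transcendental.KZ.of s) ∈ Literature.NumberTheory.Transcendental.KZ.relations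

/-- X₃ — π-CANCELLATION; verbatim the signature of item stmt-KontsevichZagierPeriods-0540
(`AyoubSpecialisation.AyoubPiCancellation` = `KatzTower.PiCancellation`). -/
def AyoubPiCancellation : Prop :=
  ∀ (P : ∀ n : ℕ, Literature.NumberTheory.Transcendental.KZ.IntegralRep n → Literature.NumberTheory.Transcendental.KZ.IntegralRep (n + 2)), (∀ (n : ℕ) (r : Literature.NumberTheory.Transcendental.KZ.IntegralRep n), (P n r).domain = {z : Fin (n + 2) → ℝ | z 0 ^ 2 + z 1 ^ 2 ≤ 1 ∧ (fun i : Fin n => z i.succ.succ) ∈ r.domain} ∧ (P n r).integrand = fun z => r.integrand (fun i : Fin n => z i.succ.succ)) → ∀ c : Literature.NumberTheory.Transcendental.KZ.FormalRep, FreeAbelianGroup.lift (fun s : (Σ n, Literature.NumberTheory.Transcendental.KZ.IntegralRep n) => Literature.NumberTheory.Transcendental.KZ.of (P s.1 s.2)) c ∈ Literature.NumberTheory.Transcendental.KZ.relations → c ∈ Literature.NumberTheory.Transcendental.KZ.relations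

/-- **π-peeling**: under π-cancellation, `([π]⋆)^[N] x ∈ relations → x ∈ relations`. [folklore] -/
theorem peel_of_piCancellation (h2 : AyoubPiCancellation)
    (P : ∀ n : ℕ, IntegralRep n → IntegralRep (n + 2))
    (hP : ∀ (n : ℕ) (r : IntegralRep n), (P n r).domain = {z : Fin (n + 2) → ℝ | z 0 ^ 2 + z 1 ^ 2 ≤ 1 ∧
        (fun i : Fin n => z i.succ.succ) ∈ r.domain} ∧
      (P n r).integrand = fun z => r.integrand (fun i : Fin n => z i.succ.succ)) :
    ∀ (N : ℕ) (x : FormalRep),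
      (⇑(FreeAbelianGroup.lift (fun t : (Σ n, IntegralRep n) => of (P t.1 t.2))))^[N] x ∈ relations →
        x ∈ relations := by
  intro N
  induction N with
  | zero => intro x hx; simpa using hx
  | succ N ih =>
      intro x hx
      rw [Function.iterate_succ_apply'] at hx
      exact ih x (h2 P hP _ hx)

/-- **THE SPLIT GLUE** `X₁ → X₂ → X₃ → PiPowerStratum`.  Given KZ-rational `r`, `r'` with equal values:
resolve both into the tame cubical span (X₁); the difference of the two resolutions is merged into ONE
tame cube class (`stub_cubeMerge`, landed) and made Ayoub-admissible inside the moves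
(`stub_admissibleOfTame`, landed); by soundness its value is `r.value − r'.value = 0`; X₂ gives a
disc-power multiple in `relations` for a pinned product that EXISTS (`exists_pinnedProduct`, landed);
X₃ peels the discs; the four congruences add up to `[r] − [r'] ∈ relations`. -/
theorem piPowerStratum_of_subs (h1 : CubeResolution) (hK : AyoubCubeLocalKernel)
    (h2 : AyoubPiCancellation) : PiPowerStratum := by
  intro n m r r' _hr _hr' hv _hpi
  obtain ⟨P, hP⟩ :=
    Summit.KontsevichZagierPeriods.HurwitzMicroSectors.NormalFormPrincipleSplitGlue.exists_pinnedProduct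
  -- (1) resolve both representations into the tame cubical span
  obtain ⟨a, ha, hra⟩ := h1 n r
  obtain ⟨a', ha', hra'⟩ := h1 m r'
  -- (2) merge the difference to one tame cube class `t`, then to an admissible class `s`
  have hc : a - a' ∈ cubicalSpan := cubicalSpan.sub_mem ha ha'
  obtain ⟨k, t, htd, hta, hct⟩ := stub_cubeMerge (a - a') hc
  rw [leaves_unitCube_eq_cube] at htd hta
  obtain ⟨s, hsd, hadm, hts⟩ := stub_admissibleOfTame k t htd hta
  -- (3) soundness: `s.value = 0`
  have hs0 : s.value = 0 := by
    have e1 : eval (of r - a) = 0 := relations_le_ker_eval_holds hra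
    have e2 : eval (of r' - a') = 0 := relations_le_ker_eval_holds hra'
    have e3 : eval (a - a' - of t) = 0 := relations_le_ker_eval_holds hct
    have e4 : eval (of t - of s) = 0 := relations_le_ker_eval_holds hts
    simp only [map_sub, eval_of] at e1 e2 e3 e4
    linarith
  -- (4) the localised kernel on the admissible cube class
  obtain ⟨N, hN⟩ := hK P hP k s hsd hadm hs0
  -- (5) peel the discs
  have hs : of s ∈ relations := peel_of_piCancellation h2 P hP N (of s) hN
  -- (6) add up
  show of r - of r' ∈ relations
  have key : of r - of r' = (of r - a) - (of r' - a') + (a - a' - of t) + (of t - of s) + of s := by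
    abel
  rw [key]
  exact relations.add_mem (relations.add_mem (relations.add_mem (relations.sub_mem hra hra') hct) hts) hs

/-! ### Sanity: the pieces are consequences of the known leaves (recorded, not used by the glue) -/

/-- X₂ follows from stmt-0541 `AyoubPiLocalKernel` (verbatim) by restriction to `c := [s]`. [folklore] -/
theorem ayoubCubeLocalKernel_of_piLocalKernel
    (h : ∀ (P : ∀ n : ℕ, Literature.NumberTheory.Transcendental.KZ.IntegralRep n → Literature.NumberTheory.Transcendental.KZ.IntegralRep (n + 2)), (∀ (n : ℕ) (r : Literature.NumberTheory.Transcendental.KZ.IntegralRep n), (P n r).domain = {z : Fin (n + 2) → ℝ | z 0 ^ 2 + z 1 ^ 2 ≤ 1 ∧ (fun i : Fin n => z i.succ.succ) ∈ r.domain} ∧ (P n r).integrand = fun z => r.integrand (fun i : Fin n => z i.succ.succ)) → ∀ c : Literature.NumberTheory.Transcendental.KZ.FormalRep, Literature.NumberTheory.Transcendental.KZ.eval c = 0 → ∃ N : ℕ, (⇑(FreeAbelianGroup.lift (fun s : (Σ n, Literature.NumberTheory.Transcendental.KZ.IntegralRep n) => Literature.NumberTheory.Transcendental.KZ.of (P s.1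 s.2))))^[N] c ∈ Literature.NumberTheory.Transcendental.KZ.relations) :
    AyoubCubeLocalKernel := by
  intro P hP m s _ _ hs0
  exact h P hP (of s) (by rw [eval_of, hs0])

end Summit.KontsevichZagierPeriods.KontsevichZagierPeriods.Cruxes.PiPowerStratum.Split
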